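import Literature.NumberTheory.GelbartRogawski1991.FiniteAdelicWeilCentralCoinvariantsIrreducible
import Literature.NumberTheory.Automorphic.RestrictedTensorProductAdmissibleProofs
import HarnessLib

/-!
# `Coinv(⊗'_v ω_v ∘ Πʳφ, ∏χ_v)` is ADMISSIBLE when the local quotients are admissible and almost all have a `K_v`-fixed line (Flath)

Topic `NumberTheory/GelbartRogawski1991`.  Theorems only (no definition, no record, no named fact, no `sorry`).
The ADMISSIBILITY twin of `FiniteAdelicWeilCentralCoinvariantsIrreducible.lean` (same carriers, same binders, with the
local input «irreducible» (`hirr`) replaced by «the `K_v`-fixed vectors of the local quotient have dimension `≤ 1` for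
almost all `v`» (`hsph`) and the conclusion `IsIrreducible` replaced by `IsAdmissible`):

* §1 `finiteAdeleRep_centralCoinv_isAdmissible` — for the tree's place-assembled `finiteAdeleRep K ι r hK = ⊗'_v r_v`
  on `𝒮((𝔸_{K,f})^ι)` and a central restricted sub-family `φ_v : H_v →* G_v`: if every local quotient
  `Coinv(r_v ∘ φ_v, χ_v)` with its `G_v`-action is ADMISSIBLE, its `K_v`-fixed vectors have dimension `≤ 1` for almost
  all `v`, and the class of the unramified vector `[1_{𝒪_v^ι}]` is non-zero off a finite set `S₁` (`hx₀N`), then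
  `Coinv(⊗'_v r_v ∘ Πʳφ, ∏χ_v)` is an ADMISSIBLE representation of `Πʳ_v [G_v, K_v]`.  Proof: the coinvariants ARE
  `⊗'_v Coinv(r_v ∘ φ_v, χ_v)` w.r.t. the classes `[1_{𝒪_v^ι}]` (`finiteAdeleRep_centralCoinv`, comparison map from
  `exists_centralCoinvMap`), and Flath's admissibility of restricted tensor products
  (`IsRestrictedTensorProductRep.isAdmissible_of`, [Flath1979, §2 Example 2]) applies once its spherical clause
  `∀ᶠ v, IsSpherical (K_v) ∧ [1_{𝒪_v^ι}] ≠ 0` is assembled (`eventually_isSpherical_and_ne_zero`): `finrank = 1` because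
  `≤ 1` is `hsph` and `≥ 1` is witnessed by the NON-ZERO (`hx₀N`) `K_v`-FIXED
  (`IsRestrictedTensorProductRep.eventually_mk_mem_fixedPoints`) class `[1_{𝒪_v^ι}]` inside the finite-dimensional
  (`hadm v`) fixed space — Mathlib's convention `finrank = 0` for modules of infinite rank is harmless exactly because the
  local factor is admissible.
* §2 `FinLocalSplittings.omegaPi_centralCoinv_isAdmissible` — the unitary instance: for a family `𝓢` of local
  splittings `s_v : U(J)(F_v) →* S̃p_{ψ_v}(𝕎_v)` the `Πʳ_v [U(J)(F_v), U(J)(𝒪_v)]`-action `TwistedCoinv.rep χ 𝓢.OmegaPi hcomm`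
  on `Coinv(Ω ∘ Πʳφ, χ)`, `Ω = 𝓢.OmegaPi = ⊗'_v ω_v`, is admissible under the same local inputs (`U(J)(𝒪_v)` compact open:
  `isOpen_localInt`, `isCompact_localInt`).

With `φ_v` the local centre `E_v¹ ↪ U(V)(F_v)` this is the «admissible» of [Liu2021, Def. 4.11 (`FJcycle.tex`
l. 2092–2096)] — «`ω(μ, ε, χ) := ⊗'_v ω(μ_v, ε_v, χ_v)`, which is an irreducible admissible representation of
`𝔾(𝔸_F^∞)`» — REDUCED, in the kernel, to LOCAL inputs: admissibility of the local quotients ([Liu2021, App. D Lem. D.1,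
first sentence (l. 5227)]), «`dim ≤ 1`» of their hyperspecial fixed vectors for almost all `v` (a Gelfand-pair statement,
[GetzHahn2024, Thm. 5.5.1 with Prop. 2.4.3]), and the survival of the unramified vector (`hx₀N`).  The transport from
`Πʳ_v [U(J)(F_v), U(J)(𝒪_v)]` to `U(J)(𝔸_{F,f})` and to Liu's carriers is NOT done here.  Nothing of [Liu2021] is asserted;
HC_CM is not mentioned by this file.

## References
* [Flath1979] D. Flath, *Decomposition of representations into tensor products*, PSPM 33 (1979) part 1, §2 Example 2.
* [Bump1997] D. Bump, *Automorphic forms and representations* (1997), §3.3 pp. 293–294, Prop. 3.4.9, Thm. 3.4.4.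
* [Liu2021] Y. Liu, Camb. J. Math. 9 (2021) = arXiv:2102.11518: Def. 4.11 (l. 2083–2097), App. D Lem. D.1 (l. 5227).
* [GetzHahn2024] J. Getz, H. Hahn, *An introduction to automorphic representations* (2024), Thm. 5.5.1, Prop. 2.4.3.
* [GelbartRogawski1991] S. Gelbart, J. Rogawski, Invent. Math. 105 (1991), §3.1 Prop. 3.1.1 p. 455.
-/

noncomputable section

open scoped RestrictedProduct TensorProduct
open Filter Function Set IsDedekindDomain NumberField Module
open Literature.RepresentationTheory

/-! ### §1 The place-assembled finite-adelic representation: admissible central coinvariants -/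

namespace Literature.NumberTheory.Automorphic

universe uG uH

section Weil

variable (K : Type) [Field K] [NumberField K] (ι : Type) [Fintype ι] [DecidableEq (HeightOneSpectrum (𝓞 K))]
  {G : HeightOneSpectrum (𝓞 K) → Type uG} [∀ v, Group (G v)] {Kc : ∀ v, Subgroup (G v)}
  (r : ∀ v, Representation ℂ (G v) ↥(SchwartzBruhat (ι → v.adicCompletion K)))
  (hK : ∀ᶠ v in cofinite, unitVec K ι v ∈ (r v).fixedPoints (Kc v))
  {H : HeightOneSpectrum (𝓞 K) → Type uH} [∀ v, Group (H v)] {KH : ∀ v, Subgroup (H v)}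
  (φ : ∀ v, H v →* G v) (hφ : ∀ᶠ v in cofinite, MapsTo (φ v) (KH v) (Kc v))
  {χloc : ∀ v, H v →* ℂˣ}
  [∀ v, TopologicalSpace (G v)] [∀ v, IsTopologicalGroup (G v)]

omit [DecidableEq (HeightOneSpectrum (𝓞 K))] [∀ v, IsTopologicalGroup (G v)] in
/-- **The spherical clause of Flath's admissibility theorem, assembled from `≤ 1` and survival.**  If every local
quotient `Coinv(r_v ∘ φ_v, χ_v)` with its `G_v`-action is admissible, its `K_v`-fixed vectors have dimension `≤ 1`
for almost all `v`, and `[1_{𝒪_v^ι}] ≠ 0` off a finite `S₁`, then for almost all `v` the local quotient is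
`K_v`-SPHERICAL (`finrank = 1`) and `[1_{𝒪_v^ι}] ≠ 0`: the class `[1_{𝒪_v^ι}]` is a non-zero `K_v`-fixed vector
(`IsRestrictedTensorProductRep.eventually_mk_mem_fixedPoints`) of the finite-dimensional (admissibility, `K_v` compact
open) fixed space, so `1 ≤ finrank`. [cite: Flath1979, §2 Example 2] -/
theorem eventually_isSpherical_and_ne_zero
    (hK : ∀ᶠ v in cofinite, unitVec K ι v ∈ (r v).fixedPoints (Kc v))
    (hKo : ∀ v, IsOpen (Kc v : Set (G v))) (hKcc : ∀ v, IsCompact (Kc v : Set (G v)))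
    (hc : ∀ (v : HeightOneSpectrum (𝓞 K)) (g : G v) (h' : H v),
      Commute (r v g) ((show Representation ℂ (H v) _ from (r v).comp (φ v)) h'))
    {S₁ : Finset (HeightOneSpectrum (𝓞 K))}
    (hx₀N : ∀ v ∉ S₁,
      TwistedCoinv.mk (show Representation ℂ (H v) _ from (r v).comp (φ v)) (χloc v) (unitVec K ι v) ≠ 0)
    (hadm : ∀ v, (TwistedCoinv.rep (χloc v) (r v) (hc v)).IsAdmissible)
    (hsph : ∀ᶠ v in cofinite,
      Module.finrank ℂ ↥((TwistedCoinv.rep (χloc v) (r v) (hc v)).fixedPoints (Kc v)) ≤ 1) :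
    ∀ᶠ v in cofinite, (TwistedCoinv.rep (χloc v) (r v) (hc v)).IsSpherical (Kc v) ∧
      TwistedCoinv.mk (show Representation ℂ (H v) _ from (r v).comp (φ v)) (χloc v) (unitVec K ι v) ≠ 0 := by
  filter_upwards [hsph, IsRestrictedTensorProductRep.eventually_mk_mem_fixedPoints (χloc := χloc) hc hK,
    S₁.eventually_cofinite_notMem] with v hle hfix hv
  refine ⟨?_, hx₀N v hv⟩
  haveI : Module.Finite ℂ ↥((TwistedCoinv.rep (χloc v) (r v) (hc v)).fixedPoints (Kc v)) :=
    (hadm v).finite_fixedPoints ⟨Kc v, hKo v⟩ (hKcc v)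
  have hpos : 0 < Module.finrank ℂ ↥((TwistedCoinv.rep (χloc v) (r v) (hc v)).fixedPoints (Kc v)) :=
    Module.finrank_pos_iff_exists_ne_zero.2 ⟨⟨_, hfix⟩, fun h0 => hx₀N v hv ((Submodule.mk_eq_zero _ _).1 h0)⟩
  exact le_antisymm hle hpos

/-- **`Coinv(⊗'_v r_v ∘ Πʳφ, ∏χ_v)` is admissible** as a representation of `Πʳ_v [G_v, K_v]` whenever the `K_v` are
compact open, every local quotient `Coinv(r_v ∘ φ_v, χ_v)` with its `G_v`-action `TwistedCoinv.rep (χ_v) (r_v)` is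
admissible, its `K_v`-fixed vectors have dimension `≤ 1` for almost all `v`, and the class of the unramified vector
`[1_{𝒪_v^ι}]` is non-zero off a finite set `S₁`: the coinvariants are `⊗'_v` of the local quotients
(`finiteAdeleRep_centralCoinv`, comparison map from `exists_centralCoinvMap`), almost all factors are spherical with
non-zero base class (`eventually_isSpherical_and_ne_zero`), and Flath's admissibility theorem
`IsRestrictedTensorProductRep.isAdmissible_of` applies. [cite: Flath1979, §2 Example 2; Liu2021, Def. 4.11 (l. 2092–2096)] -/
theorem finiteAdeleRep_centralCoinv_isAdmissible
    (hKo : ∀ v, IsOpen (Kc v : Set (G v))) (hKcc : ∀ v, IsCompact (Kc v : Set (G v)))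
    (hc : ∀ (v : HeightOneSpectrum (𝓞 K)) (g : G v) (h' : H v),
      Commute (r v g) ((show Representation ℂ (H v) _ from (r v).comp (φ v)) h'))
    (hcomm : ∀ (g : Πʳ v, [G v, Kc v]) (h' : Πʳ v, [H v, KH v]),
      Commute (finiteAdeleRep K ι r hK g)
        (((finiteAdeleRep K ι r hK).comp (RestrictedProduct.mapAlongMonoidHom H G id Filter.tendsto_id φ hφ)) h'))
    (χ : (Πʳ v, [H v, KH v]) →* ℂˣ)
    (hχ : ∀ g : Πʳ v, [H v, KH v], ((χ g : ℂˣ) : ℂ) = ∏ᶠ v, ((χloc v (g v) : ℂˣ) : ℂ))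
    (hχK : ∀ᶠ v in cofinite, ∀ g ∈ KH v, χloc v g = 1)
    {S₁ : Finset (HeightOneSpectrum (𝓞 K))}
    (hx₀N : ∀ v ∉ S₁,
      TwistedCoinv.mk (show Representation ℂ (H v) _ from (r v).comp (φ v)) (χloc v) (unitVec K ι v) ≠ 0)
    (hadm : ∀ v, (TwistedCoinv.rep (χloc v) (r v) (hc v)).IsAdmissible)
    (hsph : ∀ᶠ v in cofinite,
      Module.finrank ℂ ↥((TwistedCoinv.rep (χloc v) (r v) (hc v)).fixedPoints (Kc v)) ≤ 1) :
    (TwistedCoinv.rep χ (finiteAdeleRep K ι r hK) hcomm).IsAdmissible := by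
  obtain ⟨J, hJ⟩ := (isRestrictedTensorProductRep_finiteAdeleRep K ι r hK).exists_centralCoinvMap
    (φ := φ) (hφ := hφ) (χloc := χloc) (hq := Filter.Eventually.of_forall fun _ => rfl) χ hχ
  exact IsRestrictedTensorProductRep.isAdmissible_of hKo hKcc hadm
    (eventually_isSpherical_and_ne_zero K ι r φ hK hKo hKcc hc hx₀N hadm hsph)
    (finiteAdeleRep_centralCoinv K ι r hK φ hφ hc hcomm χ hχ hχK hx₀N
      (IsRestrictedTensorProductRep.eventually_mk_mem_fixedPoints hc hK) J hJ)

end Weil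

end Literature.NumberTheory.Automorphic

/-! ### §2 The finite Weil representation of a unitary group assembled from local splittings -/

namespace Literature.NumberTheory.GelbartRogawski1991.UnitaryDualPair.LocalSplitting.FinLocalSplittings

open scoped Classical
open Literature.NumberTheory.Automorphic

universe uH

variable {F : Type} [Field F] [NumberField F] {E : Type} [Field E] [NumberField E] [Algebra F E]
  [Algebra.IsQuadraticExtension F E] {c : E ≃ₐ[F] E} {N : ℕ} {δ : E} {hcδ : c δ = -δ} {hδ : δ ≠ 0} {d : F}
  {hd : δ * δ = algebraMap F E d} {T : Matrix (Fin N) (Fin N) F} {hT : T.IsSymm}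
  {J : Matrix (Fin N) (Fin N) E} {hJ : J = T.map (algebraMap F E)}
  (𝓢 : FinLocalSplittings F E c N hcδ hδ hd T hT hJ)
  {H : HeightOneSpectrum (𝓞 F) → Type uH} [∀ v, Group (H v)] {KH : ∀ v, Subgroup (H v)}
  (φ : ∀ v, H v →* UnitaryGroup.localPi E c N J v)
  (hφ : ∀ᶠ v in cofinite, MapsTo (φ v) (KH v) (UnitaryGroup.localInt E c N J v))
  {χloc : ∀ v, H v →* ℂˣ}

/-- **[Liu2021, Def. 4.11]'s «admissible» reduced to its local inputs, on the tree's Weil carrier.**  For a family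
of local splittings `𝓢` (`s_v : U(J)(F_v) →* S̃p_{ψ_v}(𝕎_v)`, Liu's `ι_{μ_v}`), a central restricted sub-family
`φ_v : H_v →* U(J)(F_v)` (`hc`, `hcomm`), local characters `χ_v` trivial on `KH_v` almost everywhere and
`χ = ∏_v χ_v`: if EVERY local maximal `χ_v`-quotient `Coinv(ω_v ∘ φ_v, χ_v)` is an admissible representation of
`U(J)(F_v)` ([Liu2021, App. D Lem. D.1, first sentence l. 5227]), its `U(J)(𝒪_v)`-fixed vectors have dimension `≤ 1`
for almost all `v` ([GetzHahn2024, Thm. 5.5.1 + Prop. 2.4.3]: hyperspecial Gelfand pairs), and the unramified vector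
survives off a finite set `S₁` (`[1_{𝒪_vᴺ}] ≠ 0`), then the coinvariants `Coinv(Ω ∘ Πʳφ, χ)` of `Ω = ⊗'_v ω_v` form
an ADMISSIBLE representation of `Πʳ_v [U(J)(F_v), U(J)(𝒪_v)]` (`finiteAdeleRep_centralCoinv_isAdmissible` at
`r := 𝓢.omegaLoc`; `U(J)(𝒪_v)` compact open by `isOpen_localInt` / `isCompact_localInt`).
[cite: Liu2021, Def. 4.11 (l. 2092–2096), App. D Lem. D.1 (l. 5227); Flath1979, §2 Example 2] -/
theorem omegaPi_centralCoinv_isAdmissible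
    (hc : ∀ (v : HeightOneSpectrum (𝓞 F)) (g : UnitaryGroup.localPi E c N J v) (h' : H v),
      Commute (𝓢.omegaLoc v g) ((show Representation ℂ (H v) _ from (𝓢.omegaLoc v).comp (φ v)) h'))
    (hcomm : ∀ (g : Πʳ v : HeightOneSpectrum (𝓞 F), [UnitaryGroup.localPi E c N J v, UnitaryGroup.localInt E c N J v])
        (h' : Πʳ v, [H v, KH v]),
      Commute (𝓢.OmegaPi g)
        ((𝓢.OmegaPi.comp (RestrictedProduct.mapAlongMonoidHom H (fun v => UnitaryGroup.localPi E c N J v) id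
          Filter.tendsto_id φ hφ)) h'))
    (χ : (Πʳ v, [H v, KH v]) →* ℂˣ)
    (hχ : ∀ g : Πʳ v, [H v, KH v], ((χ g : ℂˣ) : ℂ) = ∏ᶠ v, ((χloc v (g v) : ℂˣ) : ℂ))
    (hχK : ∀ᶠ v in cofinite, ∀ g ∈ KH v, χloc v g = 1)
    {S₁ : Finset (HeightOneSpectrum (𝓞 F))}
    (hx₀N : ∀ v ∉ S₁,
      TwistedCoinv.mk (show Representation ℂ (H v) _ from (𝓢.omegaLoc v).comp (φ v)) (χloc v) (unitVec F (Fin N) v)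
        ≠ 0)
    (hadm : ∀ v, (TwistedCoinv.rep (χloc v) (𝓢.omegaLoc v) (hc v)).IsAdmissible)
    (hsph : ∀ᶠ v in cofinite,
      Module.finrank ℂ ↥((TwistedCoinv.rep (χloc v) (𝓢.omegaLoc v) (hc v)).fixedPoints
        (UnitaryGroup.localInt E c N J v)) ≤ 1) :
    (TwistedCoinv.rep χ 𝓢.OmegaPi hcomm).IsAdmissible :=
  finiteAdeleRep_centralCoinv_isAdmissible F (Fin N) 𝓢.omegaLoc 𝓢.unitVec_mem_fixedPoints φ hφ
    (fun v => UnitaryGroup.isOpen_localInt E c N J v) (fun v => UnitaryGroup.isCompact_localInt E c N J v) hc hcomm χ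
    hχ hχK hx₀N hadm hsph

end Literature.NumberTheory.GelbartRogawski1991.UnitaryDualPair.LocalSplitting.FinLocalSplittings

end
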